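import Literature.NumberTheory.Sieve.SmoothParityTernary
import Literature.NumberTheory.Sieve.SmoothTernaryCircle
import Literature.NumberTheory.LFunctions.VinogradovZetaSumLemmas
import Mathlib.NumberTheory.Harmonic.Bounds
import HarnessLib

/-!
# Parity-class friable ternary counts: the model count through the circle identity; summation tools

Topic `Literature/NumberTheory/Sieve`, namespace `Literature.NumberTheory.Sieve.SmoothArcs`; a PROVED tool file of
the circle-method engine of `SmoothParityTernary` ([Harper2016, §5]).  Notation: model weights
`μ_i(n) = profileModelWeight c_i Mv_i X_i α n` and model sums `M_i(β) = profileModelSum c_i Mv_i X_i α β =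
Σ_{1 ≤ n ≤ X_i} μ_i(n) e(nβ)` (`SmoothProfileModel`), the model count
`parityModelCount σ d₁ d₂ X₁ X₂ X₃ Mv₁ Mv₂ Mv₃ α c₁ c₂ c₃ = Σ 1[d₁n₁ + σd₂n₂ = n₃] μ₁μ₂μ̄₃` (`SmoothParityTernary`).

* `classProfileSum_add_int`: the profile sums `classProfileSum X y m r c θ` are `1`-periodic in `θ`;
* `parityModel_circle` (MAIN TERM OF THE MAJOR ARCS): for `N₀ ≥ 1`, `σ = ±1`, `d₁⌊X₁⌋ + d₂⌊X₂⌋ + ⌊X₃⌋ < N₀` and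
  EVERY shift `t`,
  `Σ_{r<N₀} M₁(d₁(r/N₀ + t)) M₂(σd₂(r/N₀ + t)) conj M₃(r/N₀ + t) = N₀ · parityModelCount`
  (`ternary_circle_identity` with `d₃ = 1` and the weights `μ_i` on `[1, ⌊X_i⌋]`);
* `norm_sum_ite_intCast_eq_le`: a sum `Σ_{n ∈ s} 1[m = n] F(n)` over naturals has at most one term;
* `norm_parityModelCount_le`: `‖parityModelCount‖ ≤ (Mv₁Σ‖c₁‖)(Mv₂Σ‖c₂‖)(Mv₃Σ‖c₃‖)/X₃` (`Mv_i ≥ 0`, `X_i > 0`, `α ≥ 0`;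
  `‖μ_i(n)‖ ≤ (Mv_i/X_i)Σ‖c_i‖`, `⌊X_i⌋ ≤ X_i` choices of `n₁, n₂`, then `n₃` is determined);
* elementary tools for the summation over the sample points `r/N₀` (used by `SmoothParityMajorLattice` and the
  major-arc file): the harmonic-type bounds `sum_Icc_inv_le_one_add_log'` (`Σ_{j ≤ U} 1/j ≤ 1 + log U`),
  `sum_range_inv_one_add_mul_le` (`Σ_{j<N} 1/(1+aj) ≤ 1 + (1 + log N)/a`), `sum_Icc_inv_mul_inv_le` (TWO DECAYING
  FACTORS: `Σ_{1 ≤ j ≤ J} 1/((1+aj)(1+bj)) ≤ (3 + |log b|)/a` for `0 < b ≤ a`); `sum_range_comp_mul_eq_of_coprime`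
  (a dilation `d` prime to `N₀` permutes the sample points under a `1`-periodic function) and `distInt_natCast_mul`
  (`‖du‖ = d‖u‖` when `d‖u‖ ≤ 1/2`, `‖·‖ = distInt`), for the resonances of `M_i(d_iβ)` at `β ∈ (1/d_i)ℤ`.

## References

* A. J. Harper, Compositio Math. 152 (2016), §5 [Harper2016].
-/

noncomputable section

open Finset Real Complex
open scoped FourierTransform

namespace Literature.NumberTheory.Sieve

namespace SmoothArcs

open Vinogradov

/-! ### Periodicity of the profile sums -/

/-- `classProfileSum X y m r c (θ + n) = classProfileSum X y m r c θ` for `n ∈ ℤ` (`e(n'(θ + n)) = e(n'θ)`). [folklore] -/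
theorem classProfileSum_add_int (X : ℝ) (y m r : ℕ) (c : ℤ → ℂ) (θ : ℝ) (n : ℤ) :
    classProfileSum X y m r c (θ + n) = classProfileSum X y m r c θ := by
  unfold classProfileSum
  refine Finset.sum_congr rfl fun n' _ => ?_
  congr 1
  have : (n' : ℝ) * (θ + n) = (n' : ℝ) * θ + ((n' * n : ℤ) : ℝ) := by push_cast; ring
  rw [this, AddChar.map_add_eq_mul, Circle.coe_mul, RamanujanSum.fourierChar_intCast, mul_one]

/-- `classProfileSum X y m r c (θ - n) = classProfileSum X y m r c θ` for `n ∈ ℤ`. [folklore] -/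
theorem classProfileSum_sub_int (X : ℝ) (y m r : ℕ) (c : ℤ → ℂ) (θ : ℝ) (n : ℤ) :
    classProfileSum X y m r c (θ - n) = classProfileSum X y m r c θ := by
  have h := classProfileSum_add_int X y m r c θ (-n)
  rwa [Int.cast_neg, ← sub_eq_add_neg] at h

/-! ### The model count through the circle identity -/

/-- **The model sums satisfy the circle identity exactly.**  For `N₀ ≥ 1`, `σ = ±1`,
`d₁⌊X₁⌋ + d₂⌊X₂⌋ + ⌊X₃⌋ < N₀` (no wrap-around) and every real shift `t`:
`Σ_{r<N₀} M₁(d₁(r/N₀+t)) M₂(σd₂(r/N₀+t)) conj M₃(r/N₀+t) = N₀ · parityModelCount σ d₁ d₂ X₁ X₂ X₃ Mv₁ Mv₂ Mv₃ α c₁ c₂ c₃`.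
[cite: Harper2016, §5] -/
theorem parityModel_circle {N₀ : ℕ} (hN : N₀ ≠ 0) {σ : ℤ} (hσ : σ = 1 ∨ σ = -1) {d₁ d₂ : ℕ} {X₁ X₂ X₃ : ℝ}
    (hwrap : d₁ * ⌊X₁⌋₊ + d₂ * ⌊X₂⌋₊ + ⌊X₃⌋₊ < N₀) (Mv₁ Mv₂ Mv₃ α : ℝ) (c₁ c₂ c₃ : ℤ → ℂ) (t : ℝ) :
    ∑ r ∈ Finset.range N₀,
        profileModelSum c₁ Mv₁ X₁ α ((d₁ : ℝ) * ((r : ℝ) / N₀ + t)) *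
          profileModelSum c₂ Mv₂ X₂ α ((σ : ℝ) * d₂ * ((r : ℝ) / N₀ + t)) *
          starRingEnd ℂ (profileModelSum c₃ Mv₃ X₃ α ((r : ℝ) / N₀ + t)) =
      (N₀ : ℂ) * parityModelCount σ d₁ d₂ X₁ X₂ X₃ Mv₁ Mv₂ Mv₃ α c₁ c₂ c₃ := by
  have hwrap' : d₁ * ⌊X₁⌋₊ + d₂ * ⌊X₂⌋₊ + 1 * ⌊X₃⌋₊ < N₀ := by rwa [one_mul]
  have h := ternary_circle_identity hN ⌊X₁⌋₊ ⌊X₂⌋₊ ⌊X₃⌋₊ d₁ d₂ 1 σ hσ hwrap'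
    (profileModelWeight c₁ Mv₁ X₁ α) (profileModelWeight c₂ Mv₂ X₂ α) (profileModelWeight c₃ Mv₃ X₃ α) t
  simp only [Nat.cast_one, one_mul] at h
  unfold parityModelCount
  rw [← h]
  rfl

/-! ### The size of the model count -/

/-- A sum `Σ_{n ∈ s} 1[m = n] F(n)` over a finite set of naturals has at most the one term `n = m`:
its norm is at most any common bound `B` of the `‖F n‖`. [folklore] -/
theorem norm_sum_ite_intCast_eq_le (s : Finset ℕ) (m : ℤ) (F : ℕ → ℂ) {B : ℝ} (hF : ∀ n, ‖F n‖ ≤ B) : ‖∑ n ∈ s, (if m = (n : ℤ) then F n else 0)‖ ≤ B := by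
  classical
  rw [← Finset.sum_filter]
  have hsub : s.filter (fun n : ℕ => m = (n : ℤ)) ⊆ {m.toNat} := by
    intro n hn
    obtain ⟨-, hmn⟩ := Finset.mem_filter.mp hn
    rw [Finset.mem_singleton, hmn, Int.toNat_natCast]
  calc ‖∑ n ∈ s.filter (fun n : ℕ => m = (n : ℤ)), F n‖ ≤ ∑ n ∈ s.filter (fun n : ℕ => m = (n : ℤ)), ‖F n‖ :=
        norm_sum_le _ _
    _ ≤ ∑ n ∈ ({m.toNat} : Finset ℕ), ‖F n‖ := Finset.sum_le_sum_of_subset_of_nonneg hsub fun _ _ _ => norm_nonneg _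
    _ = ‖F m.toNat‖ := Finset.sum_singleton _ _
    _ ≤ B := hF _

/-- **Size of the model count**: for `Mv_i ≥ 0`, `X_i > 0`, `α ≥ 0` and absolutely summable `c_i`,
`‖parityModelCount‖ ≤ (Mv₁Σ‖c₁‖)(Mv₂Σ‖c₂‖)(Mv₃Σ‖c₃‖)/X₃` (`‖μ_i(n)‖ ≤ (Mv_i/X_i)Σ_ℓ‖c_{i,ℓ}‖`, at most `X₁X₂` pairs
`(n₁, n₂)`, and `n₃` is then determined). [cite: Harper2016, §5] -/
theorem norm_parityModelCount_le {c₁ c₂ c₃ : ℤ → ℂ} (hc₁ : Summable (fun ℓ : ℤ => ‖c₁ ℓ‖))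
    (hc₂ : Summable (fun ℓ : ℤ => ‖c₂ ℓ‖)) (hc₃ : Summable (fun ℓ : ℤ => ‖c₃ ℓ‖)) (σ : ℤ) (d₁ d₂ : ℕ)
    {X₁ X₂ X₃ Mv₁ Mv₂ Mv₃ α : ℝ} (hX₁ : 0 < X₁) (hX₂ : 0 < X₂) (hX₃ : 0 < X₃) (hMv₁ : 0 ≤ Mv₁) (hMv₂ : 0 ≤ Mv₂)
    (hMv₃ : 0 ≤ Mv₃) (hα : 0 ≤ α) :
    ‖parityModelCount σ d₁ d₂ X₁ X₂ X₃ Mv₁ Mv₂ Mv₃ α c₁ c₂ c₃‖ ≤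
      (Mv₁ * ∑' ℓ : ℤ, ‖c₁ ℓ‖) * (Mv₂ * ∑' ℓ : ℤ, ‖c₂ ℓ‖) * (Mv₃ * ∑' ℓ : ℤ, ‖c₃ ℓ‖) / X₃ := by
  set T₁ := ∑' ℓ : ℤ, ‖c₁ ℓ‖ with hT₁
  set T₂ := ∑' ℓ : ℤ, ‖c₂ ℓ‖ with hT₂
  set T₃ := ∑' ℓ : ℤ, ‖c₃ ℓ‖ with hT₃
  have hT₁0 : 0 ≤ T₁ := tsum_nonneg fun _ => norm_nonneg _
  have hT₂0 : 0 ≤ T₂ := tsum_nonneg fun _ => norm_nonneg _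
  have hT₃0 : 0 ≤ T₃ := tsum_nonneg fun _ => norm_nonneg _
  have hw₁ := norm_profileModelWeight_le hc₁ hMv₁ hX₁ hα (c := c₁)
  have hw₂ := norm_profileModelWeight_le hc₂ hMv₂ hX₂ hα (c := c₂)
  have hw₃ := norm_profileModelWeight_le hc₃ hMv₃ hX₃ hα (c := c₃)
  have hB₃ : 0 ≤ Mv₃ / X₃ * T₃ := mul_nonneg (div_nonneg hMv₃ hX₃.le) hT₃0
  unfold parityModelCount
  -- innermost sum: at most one `n₃`
  have hin : ∀ n₁ n₂ : ℕ, ‖∑ n₃ ∈ Icc 1 ⌊X₃⌋₊, (if (d₁ * n₁ : ℤ) + σ * (d₂ * n₂) = n₃ then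
      profileModelWeight c₁ Mv₁ X₁ α n₁ * profileModelWeight c₂ Mv₂ X₂ α n₂ *
        starRingEnd ℂ (profileModelWeight c₃ Mv₃ X₃ α n₃) else 0)‖ ≤
      (Mv₁ / X₁ * T₁) * (Mv₂ / X₂ * T₂) * (Mv₃ / X₃ * T₃) := by
    intro n₁ n₂
    refine norm_sum_ite_intCast_eq_le _ _ _ fun n₃ => ?_
    rw [norm_mul, norm_mul, Complex.norm_conj]
    exact mul_le_mul (mul_le_mul (hw₁ n₁) (hw₂ n₂) (norm_nonneg _) (by positivity)) (hw₃ n₃) (norm_nonneg _)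
      (by positivity)
  have hcard : ∀ X : ℝ, 0 < X → ((Icc 1 ⌊X⌋₊).card : ℝ) ≤ X := fun X hX => by
    rw [Nat.card_Icc, Nat.add_sub_cancel]; exact Nat.floor_le hX.le
  calc ‖∑ n₁ ∈ Icc 1 ⌊X₁⌋₊, ∑ n₂ ∈ Icc 1 ⌊X₂⌋₊, ∑ n₃ ∈ Icc 1 ⌊X₃⌋₊,
        (if (d₁ * n₁ : ℤ) + σ * (d₂ * n₂) = n₃ then
          profileModelWeight c₁ Mv₁ X₁ α n₁ * profileModelWeight c₂ Mv₂ X₂ α n₂ *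
            starRingEnd ℂ (profileModelWeight c₃ Mv₃ X₃ α n₃) else 0)‖
      ≤ ∑ n₁ ∈ Icc 1 ⌊X₁⌋₊, ∑ n₂ ∈ Icc 1 ⌊X₂⌋₊, (Mv₁ / X₁ * T₁) * (Mv₂ / X₂ * T₂) * (Mv₃ / X₃ * T₃) := by
        refine (norm_sum_le _ _).trans (Finset.sum_le_sum fun n₁ _ => ?_)
        exact (norm_sum_le _ _).trans (Finset.sum_le_sum fun n₂ _ => hin n₁ n₂)
    _ = ((Icc 1 ⌊X₁⌋₊).card : ℝ) * (((Icc 1 ⌊X₂⌋₊).card : ℝ) * ((Mv₁ / X₁ * T₁) * (Mv₂ / X₂ * T₂) * (Mv₃ / X₃ * T₃))) := by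
        rw [Finset.sum_const, nsmul_eq_mul, Finset.sum_const, nsmul_eq_mul]
    _ ≤ X₁ * (X₂ * ((Mv₁ / X₁ * T₁) * (Mv₂ / X₂ * T₂) * (Mv₃ / X₃ * T₃))) :=
        mul_le_mul (hcard X₁ hX₁) (mul_le_mul_of_nonneg_right (hcard X₂ hX₂) (by positivity)) (by positivity) hX₁.le
    _ = (Mv₁ * T₁) * (Mv₂ * T₂) * (Mv₃ * T₃) / X₃ := by
        field_simp

/-! ### Harmonic-type sums -/

/-- `Σ_{1 ≤ j ≤ U} 1/j ≤ 1 + log U` (Mathlib's `harmonic_le_one_add_log`). [folklore] -/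
theorem sum_Icc_inv_le_one_add_log' (U : ℕ) : ∑ j ∈ Icc 1 U, (1 : ℝ) / j ≤ 1 + Real.log U := by
  have h := harmonic_le_one_add_log U
  rw [harmonic_eq_sum_Icc] at h
  push_cast at h
  simpa only [one_div] using h

/-- `Σ_{j<N} 1/(1 + aj) ≤ 1 + (1 + log N)/a` for `a > 0` (the term `j = 0`, and `1/(1+aj) ≤ 1/(aj)` for `j ≥ 1`).
[folklore] -/
theorem sum_range_inv_one_add_mul_le {a : ℝ} (ha : 0 < a) (N : ℕ) :
    ∑ j ∈ Finset.range N, 1 / (1 + a * j) ≤ 1 + (1 + Real.log N) / a := by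
  have hlog : 0 ≤ Real.log N := Real.log_natCast_nonneg N
  rcases Nat.eq_zero_or_pos N with rfl | hN
  · simp only [Finset.range_zero, Finset.sum_empty]
    positivity
  · obtain ⟨M, rfl⟩ : ∃ M, N = M + 1 := ⟨N - 1, by omega⟩
    rw [Finset.range_eq_Ico, Finset.sum_eq_sum_Ico_succ_bot (Nat.succ_pos M), Nat.cast_zero, mul_zero, add_zero,
      div_one]
    refine add_le_add le_rfl ?_
    have h1 : ∑ j ∈ Ico 1 (M + 1), 1 / (1 + a * (j : ℝ)) ≤ ∑ j ∈ Icc 1 M, (1 / a) * (1 / (j : ℝ)) := by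
      rw [show Ico 1 (M + 1) = Icc 1 M from rfl]
      refine Finset.sum_le_sum fun j hj => ?_
      have hj1 : (1 : ℝ) ≤ j := by exact_mod_cast (Finset.mem_Icc.mp hj).1
      rw [one_div_mul_one_div, one_div_le_one_div (by positivity) (by positivity)]
      linarith
    refine h1.trans ?_
    have hlogM : Real.log M ≤ Real.log ((M + 1 : ℕ) : ℝ) := by
      rcases Nat.eq_zero_or_pos M with rfl | hM
      · simp
      · exact Real.log_le_log (by exact_mod_cast hM) (by push_cast; linarith)
    rw [← Finset.mul_sum]
    calc 1 / a * ∑ j ∈ Icc 1 M, 1 / (j : ℝ) ≤ 1 / a * (1 + Real.log M) :=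
          mul_le_mul_of_nonneg_left (sum_Icc_inv_le_one_add_log' M) (by positivity)
      _ ≤ 1 / a * (1 + Real.log ((M + 1 : ℕ) : ℝ)) := mul_le_mul_of_nonneg_left (by linarith) (by positivity)
      _ = (1 + Real.log ((M + 1 : ℕ) : ℝ)) / a := by ring

/-- **Two decaying factors.** For `0 < b ≤ a` and every `J`:
`Σ_{1 ≤ j ≤ J} 1/((1+aj)(1+bj)) ≤ (3 + |log b|)/a`
(`j ≤ 1/b`: `≤ 1/(aj)`, harmonic sum `≤ (1 + log(1/b))/a`; `j > 1/b`: `≤ 1/(ab j²)`, tail `≤ 2/a`). [folklore] -/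
theorem sum_Icc_inv_mul_inv_le {a b : ℝ} (hb : 0 < b) (hba : b ≤ a) (J : ℕ) :
    ∑ j ∈ Icc 1 J, 1 / ((1 + a * j) * (1 + b * j)) ≤ (3 + |Real.log b|) / a := by
  have ha : 0 < a := lt_of_lt_of_le hb hba
  set U : ℕ := ⌊1 / b⌋₊ with hU
  have hUle : (U : ℝ) ≤ 1 / b := Nat.floor_le (by positivity)
  have hUlt : 1 / b < (U : ℝ) + 1 := Nat.lt_floor_add_one _
  set f : ℕ → ℝ := fun j => 1 / ((1 + a * j) * (1 + b * j)) with hf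
  have hf0 : ∀ j : ℕ, 0 ≤ f j := fun j => by positivity
  -- part 1: `j ≤ U`
  have h1 : ∑ j ∈ (Icc 1 J).filter (fun j => j ≤ U), f j ≤ (1 + |Real.log b|) / a := by
    have hsub : (Icc 1 J).filter (fun j => j ≤ U) ⊆ Icc 1 U := by
      intro j hj
      rw [Finset.mem_filter, Finset.mem_Icc] at hj
      exact Finset.mem_Icc.mpr ⟨hj.1.1, hj.2⟩
    calc ∑ j ∈ (Icc 1 J).filter (fun j => j ≤ U), f j ≤ ∑ j ∈ Icc 1 U, f j :=
          Finset.sum_le_sum_of_subset_of_nonneg hsub fun j _ _ => hf0 j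
      _ ≤ ∑ j ∈ Icc 1 U, (1 / a) * (1 / (j : ℝ)) := by
          refine Finset.sum_le_sum fun j hj => ?_
          have hj1 : (1 : ℝ) ≤ j := by exact_mod_cast (Finset.mem_Icc.mp hj).1
          simp only [hf]
          rw [one_div_mul_one_div, one_div_le_one_div (by positivity) (by positivity)]
          have h0 : 0 ≤ b * j := by positivity
          have h0' : 0 ≤ a * j := by positivity
          nlinarith [mul_nonneg h0' h0]
      _ = (1 / a) * ∑ j ∈ Icc 1 U, 1 / (j : ℝ) := by rw [Finset.mul_sum]
      _ ≤ (1 / a) * (1 + Real.log U) := mul_le_mul_of_nonneg_left (sum_Icc_inv_le_one_add_log' U) (by positivity)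
      _ ≤ (1 / a) * (1 + |Real.log b|) := by
          refine mul_le_mul_of_nonneg_left (add_le_add le_rfl ?_) (by positivity)
          rcases Nat.eq_zero_or_pos U with hU0 | hU0
          · rw [hU0, Nat.cast_zero, Real.log_zero]; exact abs_nonneg _
          · calc Real.log U ≤ Real.log (1 / b) := Real.log_le_log (by exact_mod_cast hU0) hUle
              _ = -Real.log b := by rw [one_div, Real.log_inv]
              _ ≤ |Real.log b| := neg_le_abs _
      _ = (1 + |Real.log b|) / a := by ring
  -- part 2: `j > U`
  have h2 : ∑ j ∈ (Icc 1 J).filter (fun j => ¬ j ≤ U), f j ≤ 2 / a := by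
    have hsub : (Icc 1 J).filter (fun j => ¬ j ≤ U) ⊆ Ioo U (J + 1) := by
      intro j hj
      rw [Finset.mem_filter, Finset.mem_Icc] at hj
      exact Finset.mem_Ioo.mpr ⟨by omega, by omega⟩
    have hkey : ∀ j ∈ Ioo U (J + 1), f j ≤ (1 / (a * b)) * ((j : ℝ) ^ 2)⁻¹ := by
      intro j hj
      have hjU : (U : ℝ) + 1 ≤ j := by exact_mod_cast (Finset.mem_Ioo.mp hj).1
      have hj0 : (0 : ℝ) < j := by linarith [Nat.cast_nonneg (α := ℝ) U]
      have haj : 0 < a * j := mul_pos ha hj0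
      have hbj : 0 < b * j := mul_pos hb hj0
      simp only [hf]
      calc 1 / ((1 + a * j) * (1 + b * j)) ≤ 1 / ((a * j) * (b * j)) :=
            one_div_le_one_div_of_le (mul_pos haj hbj) (by nlinarith)
        _ = (1 / (a * b)) * ((j : ℝ) ^ 2)⁻¹ := by rw [one_div, one_div, ← mul_inv]; congr 1; ring
    have hbU : 1 < ((U : ℝ) + 1) * b := (div_lt_iff₀ hb).mp hUlt
    calc ∑ j ∈ (Icc 1 J).filter (fun j => ¬ j ≤ U), f j ≤ ∑ j ∈ Ioo U (J + 1), f j :=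
          Finset.sum_le_sum_of_subset_of_nonneg hsub fun j _ _ => hf0 j
      _ ≤ ∑ j ∈ Ioo U (J + 1), (1 / (a * b)) * ((j : ℝ) ^ 2)⁻¹ := Finset.sum_le_sum hkey
      _ = (1 / (a * b)) * ∑ j ∈ Ioo U (J + 1), ((j : ℝ) ^ 2)⁻¹ := by rw [Finset.mul_sum]
      _ ≤ (1 / (a * b)) * (2 / (U + 1)) := mul_le_mul_of_nonneg_left (sum_Ioo_inv_sq_le U (J + 1)) (by positivity)
      _ = 2 / a * (1 / (((U : ℝ) + 1) * b)) := by field_simp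
      _ ≤ 2 / a * 1 := by
          refine mul_le_mul_of_nonneg_left ?_ (by positivity)
          rw [div_le_one (by positivity)]; exact hbU.le
      _ = 2 / a := mul_one _
  rw [← Finset.sum_filter_add_sum_filter_not (Icc 1 J) (fun j => j ≤ U) f]
  have e : (3 + |Real.log b|) / a = (1 + |Real.log b|) / a + 2 / a := by ring
  rw [e]
  exact add_le_add h1 h2

/-! ### Dilations prime to `N₀`, and `‖du‖ = d‖u‖` -/

/-- **A dilation prime to `N₀` permutes the sample points**: for `ψ` of period `1` and `(d, N₀) = 1`,
`Σ_{r<N₀} ψ(d r/N₀ + c) = Σ_{r<N₀} ψ(r/N₀ + c)`. [folklore] -/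
theorem sum_range_comp_mul_eq_of_coprime {N₀ d : ℕ} (hN : 0 < N₀) (hd : Nat.Coprime d N₀) {ψ : ℝ → ℝ}
    (hψ : ∀ (v : ℝ) (n : ℤ), ψ (v + n) = ψ v) (c : ℝ) :
    ∑ r ∈ Finset.range N₀, ψ ((d * r : ℕ) / (N₀ : ℝ) + c) = ∑ r ∈ Finset.range N₀, ψ ((r : ℝ) / N₀ + c) := by
  classical
  have hN0 : (0 : ℝ) < N₀ := by exact_mod_cast hN
  set e : ℕ → ℕ := fun r => d * r % N₀ with he
  have hinj : Set.InjOn e (Finset.range N₀ : Set ℕ) := by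
    intro r₁ hr₁ r₂ hr₂ h12
    have hr₁' := Finset.mem_range.mp (Finset.mem_coe.mp hr₁)
    have hr₂' := Finset.mem_range.mp (Finset.mem_coe.mp hr₂)
    have hmod : d * r₁ ≡ d * r₂ [MOD N₀] := h12
    have h := Nat.ModEq.cancel_left_of_coprime (by rwa [Nat.gcd_comm] ) hmod
    exact Nat.ModEq.eq_of_lt_of_lt h hr₁' hr₂'
  have himage : (Finset.range N₀).image e = Finset.range N₀ := by
    refine Finset.eq_of_subset_of_card_le (fun s hs => ?_) ?_
    · obtain ⟨r, -, rfl⟩ := Finset.mem_image.mp hs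
      exact Finset.mem_range.mpr (Nat.mod_lt _ hN)
    · rw [Finset.card_image_of_injOn hinj]
  calc ∑ r ∈ Finset.range N₀, ψ ((d * r : ℕ) / (N₀ : ℝ) + c)
      = ∑ r ∈ Finset.range N₀, ψ ((e r : ℕ) / (N₀ : ℝ) + c) := by
        refine Finset.sum_congr rfl fun r _ => ?_
        set q : ℕ := d * r / N₀ with hq
        have h1 : ((d * r : ℕ) : ℝ) = (e r : ℕ) + (N₀ : ℝ) * (q : ℝ) := by
          rw [he, hq]; exact_mod_cast (Nat.mod_add_div (d * r) N₀).symm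
        have hdecomp : ((d * r : ℕ) : ℝ) / N₀ + c = ((e r : ℕ) : ℝ) / N₀ + c + ((q : ℤ) : ℝ) := by
          rw [Int.cast_natCast, h1]; field_simp; ring
        rw [hdecomp, hψ]
    _ = ∑ s ∈ (Finset.range N₀).image e, ψ ((s : ℝ) / N₀ + c) :=
        (Finset.sum_image (f := fun s : ℕ => ψ ((s : ℝ) / N₀ + c)) hinj).symm
    _ = ∑ r ∈ Finset.range N₀, ψ ((r : ℝ) / N₀ + c) := by rw [himage]

/-- **`‖du‖ = d‖u‖` when `d‖u‖ ≤ 1/2`** (`u = round u + β`, `|dβ| ≤ 1/2`,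
`VinogradovZetaSum.distInt_eq_abs_of_abs_le_half`). [folklore] -/
theorem distInt_natCast_mul {d : ℕ} {u : ℝ} (h : (d : ℝ) * distInt u ≤ 1 / 2) :
    distInt ((d : ℝ) * u) = d * distInt u := by
  have e : (d : ℝ) * u = (d : ℝ) * (u - round u) + ((d * round u : ℤ) : ℝ) := by push_cast; ring
  rw [e, distInt_add_int]
  have habs : |(d : ℝ) * (u - round u)| = d * distInt u := by
    rw [abs_mul, Nat.abs_cast]; rfl
  rw [Literature.NumberTheory.LFunctions.VinogradovZetaSum.distInt_eq_abs_of_abs_le_half (by rw [habs]; exact h), habs]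

end SmoothArcs

end Literature.NumberTheory.Sieve

end
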